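import Literature.MathematicalPhysics.QuantumFieldTheory.Balaban1983to89.B3CxiPropagator
import HarnessLib

/-!
# B3 — T. Bałaban, *(Higgs)₂,₃ quantum fields in a finite volume. III. Renormalization*, CMP **88** (1983) 411–445
[Balaban1983Higgs3], p. 437 [PDF 27]: the printed bound **|C^ξ(y − y′)| ≦ O(1)e^{−½|y−y′|}/|y − y′|** for the free propagator
C^ξ = (−Δ^ξ + 1)^{−1} on ξℤ³, UNIFORMLY in the lattice spacing ξ ≤ 1 — PROVED by the DISCRETE MAXIMUM PRINCIPLE with an
explicit lattice supersolution (comparison-principle witness; core file of the torus member `B3CxiTorusBound`)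

statement-level skeleton of published theorems with citation tags; proofs where landed; nothing here is a claim about
the Yang–Mills mass gap

PDF held: `paper:balaban1983-higgs-2-3-quantum-fields-finite-volume` (journal page = PDF page + 410).  Read: p. 437 [PDF 27] on
the ×2 render `run/shared/lean/pub/pub-balaban/b2b-balaban-ref1/pages/1983-cmp88-higgs23-III/1983-cmp88-higgs23-III-p027-x2.png`.

CITATION HEADER (lean-in-tree rule).  Part of the lit-balaban TYPED SKELETON (HOME `run/shared/lean/pub/lit-balaban/`), Phase-2
proof seat p03, generation 3 (unit `lit-balaban-p03-g3`; TAKING line HOME/STATUS.md 2026-08-21T05:46Z).  Row served: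
**B3.Eq3.11-3.17** of `HOME/lit-balaban-r15/ROWS-B3.md` (reader/typer and fold owner r15), the p. 437 sentence quoted below,
whose C^ξ-inequality is USED AS A HYPOTHESIS downstream (`B3Ineq313Pointwise`, `B3Bound316.abs_bracket316_le` of seat p20:
`hC`) and was left unproved by `B3CxiPropagator` (r15, docstring: *"NOT CLAIMED: the printed uniform bound … the Neumann series
gives only the lattice-scale geometric decay rate … not uniform in ξ"*).  THEOREM OF RECORD for C^ξ on ξℤ³: seat p39 gen 3
(`B3CxiBesselKernel` → `B3CxiPoissonization` → `B3CxiUniformBound`, Poissonization of the random-walk series; first TAKING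
05:22Z).  THIS FILE is an INDEPENDENT SECOND WITNESS by a different method (comparison principle), written as the core of the
TORUS member (`B3CxiTorusBound`, the shape p20's `hC` consumes on `Balaban1983to89.Site P j`); it restates nothing of p39's.

THE PRINTED TEXT (verbatim, p. 437 [PDF 27]).  *"For simplicity let us denote L^{−j″} = ξ. Next we replace G^ξ_{j″}(0) by
C^ξ = (−Δ^ξ + 1)^{−1} … (3.16). Using the inequalities |C^ξ(y − y′)| ≦ O(1) e^{−½|y−y′|}/|y − y′|,
|G^ξ_{j″}(0; y, y′)| ≦ O(1) e^{−δ₀|y−y′|}/|y − y′|, and the corresponding inequalities for derivatives, we can estimate (3.16)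
by a constant."*  (d = 3: the form e^{−½|y−y′|}/|y−y′| is the three-dimensional Yukawa potential; the paper takes these
inequalities from the general propagator estimates (2.10)–(2.12) p. 426, i.e. from [Balaban1982Higgs1] Props. 2.1/2.3 by
rescaling, and prints no proof for the free propagator.)

WHAT IS PROVED, and how (d = 3; C^ξ = r15's momentum integral `B3Sect3VectorSelfEnergy.Cxi 3 ξ`, a kernel with respect to
Σ_{y′}ξ³ on integer site coordinates y ∈ ℤ³, physical point ξy).
* §1–§2  ONE-VARIABLE CALCULUS of `phi b k x = e^{−b√x}(√x)^{−k}` (x > 0): `phi′ = −(k/2)·phi_{k+2} − (b/2)·phi_{k+1}`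
  (`hasDerivAt_phi`), positivity, monotonicity; the radial profile `F0 b c s = phi b 1 (s + c)` = e^{−b√(s+c)}/√(s+c) and its
  first four derivatives `F1 … F4` as explicit nonnegative/nonpositive combinations of the `phi` (`hasDerivAt_F0 … hasDerivAt_F3`).
* §3  TAYLOR-TYPE BOUNDS proved by repeated "nonpositive derivative ⇒ antitone" (no `iteratedDeriv`): the one-sided bound
  `F0(s+1) ≤ F0 s + F1 s + ½F2 s` (`F0_add_one_le`, from F2 antitone) and the symmetric fourth-order bound
  `F0(σ+t) + F0(σ−t) ≤ 2F0 σ + t²F2 σ + (t⁴/12)·F4(σ−T)` for `0 ≤ t ≤ T ≤ σ` (`F0_symm_le`, from F4 antitone).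
* §4  THE SUPERSOLUTION: `cmp m y = F0 (m/2) 64 |y|²` = e^{−(m/2)√(|y|²+64)}/√(|y|²+64) on ℤ³ satisfies, for 0 < m ≤ 1,
  `(6 + m²)·cmp(y) − Σ_ν (cmp(y+e_ν) + cmp(y−e_ν)) ≥ 0` at every y (`lap_cmp_nonneg`) and `≥ κ₀ > 0` at y = 0
  (`lap_cmp_zero`, κ₀ = 3e^{−√65/2}/(65√65)), by §3 applied along the three coordinate steps 2y_ν around σ = |y|² + 1 and the
  scalar inequality `key_ineq` in u = √(|y|²+64) ≥ 8, b = m/2 ≤ ½ (margin 3b²u⁸ + (c − ¾)(3u⁴ + 3bu⁵ + b²u⁶) against the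
  fourth-order error (5/36)[105(5/4)⁹u⁴ + 105(5/4)⁸bu⁵ + 45(5/4)⁷b²u⁶ + 10(5/4)⁶b³u⁷ + (5/4)⁵b⁴u⁸]).
* §5  THE DISCRETE MAXIMUM PRINCIPLE on ℤ³ for −Δ₁ + m², m > 0 (`nonneg_of_superSol`: a function bounded below with
  (6 + m²)f ≥ Σ_{nbrs} f is ≥ 0), hence COMPARISON: every bounded K with (−Δ₁ + m²)K = δ₀ satisfies `K ≤ A·cmp`
  (`le_cmpConst_mul_cmp`, A = `cmpConst` = κ₀⁻¹ an absolute constant) and therefore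
  **K(y) ≤ A·e^{−(m/2)|y|}/|y| for y ≠ 0** (`green_le`, |y| Euclidean).
* §6  THE PRINTED INEQUALITY for C^ξ, 0 < ξ ≤ 1: K := ξ·C^ξ solves (−Δ₁ + ξ²)K = δ₀ by r15's lattice equation
  `B3CxiPropagator.negLapZ_Cxi_add` and is bounded by `abs_Cxi_le`, nonnegative by `Cxi_nonneg`; hence
  **`abs_Cxi_le_yukawa`: |C^ξ(y)| ≤ A·e^{−½·ξ|y|}/(ξ|y|)** (y ≠ 0, ξ|y| = the physical Euclidean distance |y − y′| of the print
  with y′ = 0; translation invariance is built into `Cxi`), and the sup-norm form `abs_Cxi_le_yukawa_sup` (|y|_∞ ≤ |y|₂).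
  The constant A = 65√65·e^{√65/2}/3 is independent of ξ: this is the printed "O(1)".
Nothing of [Balaban1983Higgs3] beyond the quoted inequality is asserted; no `def … : Prop` is introduced; axioms standard.
Deviation from print (allowed, recorded): the paper cites [Balaban1982Higgs1] for the bound; the comparison-principle proof
here is a self-contained shorter road for the free propagator.  Unit `lit-balaban-p03` (literature-prover-lit-balaban-p03-g3-0),
2026-08-21.
-/

open scoped BigOperators
open Real Set

namespace Literature.MathematicalPhysics.QuantumFieldTheory.Balaban1983to89.B3CxiComparisonBound

open B3Sect3VectorSelfEnergy B3CxiPropagator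

noncomputable section

/-! ## 1. The functions `φ_k(x) = e^{−b√x}(√x)^{−k}` and their derivative rule -/

/-- `φ_k(x) = e^{−b√x}·(√x)^{−k}` (x > 0): the building blocks of the radial Yukawa profile e^{−b|y|}/|y| = φ₁(|y|²) and
of all its derivatives in the variable s = |y|². [cite: Balaban1983Higgs3, (3.16) p.437] -/
def phi (b : ℝ) (k : ℕ) (x : ℝ) : ℝ := Real.exp (-(b * Real.sqrt x)) * (Real.sqrt x)⁻¹ ^ k

/-- kernel: φ_k > 0 on (0, ∞). [cite: Balaban1983Higgs3, (3.16) p.437] -/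
theorem phi_pos (b : ℝ) (k : ℕ) {x : ℝ} (hx : 0 < x) : 0 < phi b k x :=
  mul_pos (Real.exp_pos _) (pow_pos (inv_pos.2 (Real.sqrt_pos.2 hx)) k)

/-- kernel: φ_k ≥ 0 everywhere. [cite: Balaban1983Higgs3, (3.16) p.437] -/
theorem phi_nonneg (b : ℝ) (k : ℕ) (x : ℝ) : 0 ≤ phi b k x :=
  mul_nonneg (Real.exp_pos _).le (pow_nonneg (inv_nonneg.2 (Real.sqrt_nonneg x)) k)

/-- kernel: for b ≥ 0 each φ_k is antitone on (0, ∞) (both factors are nonnegative and antitone).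
[cite: Balaban1983Higgs3, (3.16) p.437] -/
theorem phi_antitone {b : ℝ} (hb : 0 ≤ b) (k : ℕ) {x y : ℝ} (hx : 0 < x) (hxy : x ≤ y) : phi b k y ≤ phi b k x := by
  unfold phi
  have hsx : 0 < Real.sqrt x := Real.sqrt_pos.2 hx
  have hs : Real.sqrt x ≤ Real.sqrt y := Real.sqrt_le_sqrt hxy
  refine mul_le_mul ?_ ?_ (pow_nonneg (inv_nonneg.2 (Real.sqrt_nonneg y)) k) (Real.exp_pos _).le
  · exact Real.exp_le_exp.2 (neg_le_neg (mul_le_mul_of_nonneg_left hs hb))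
  · exact pow_le_pow_left₀ (inv_nonneg.2 (Real.sqrt_nonneg y)) (inv_anti₀ hsx hs) k

/-- kernel: x·φ_{k+2}(x) = φ_k(x) (x > 0). [cite: Balaban1983Higgs3, (3.16) p.437] -/
theorem mul_phi_add_two (b : ℝ) (k : ℕ) {x : ℝ} (hx : 0 < x) : x * phi b (k + 2) x = phi b k x := by
  unfold phi
  have hs : Real.sqrt x ≠ 0 := (Real.sqrt_pos.2 hx).ne'
  have hx' : Real.sqrt x ^ 2 = x := Real.sq_sqrt hx.le
  have h2 : (Real.sqrt x)⁻¹ ^ 2 = x⁻¹ := by rw [inv_pow, hx']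
  rw [pow_add, h2]
  field_simp

/-- **The derivative rule** φ_k′(x) = −(k/2)φ_{k+2}(x) − (b/2)φ_{k+1}(x) for x > 0 — every derivative of the Yukawa profile
stays in the nonnegative cone spanned by the φ_k (complete monotonicity). [cite: Balaban1983Higgs3, (3.16) p.437] -/
theorem hasDerivAt_phi (b : ℝ) (k : ℕ) {x : ℝ} (hx : 0 < x) :
    HasDerivAt (phi b k) (-((k : ℝ) / 2) * phi b (k + 2) x - b / 2 * phi b (k + 1) x) x := by
  have hs : 0 < Real.sqrt x := Real.sqrt_pos.2 hx
  have hsq : HasDerivAt Real.sqrt (1 / (2 * Real.sqrt x)) x := Real.hasDerivAt_sqrt hx.ne'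
  -- the exponential factor
  have hE : HasDerivAt (fun y => Real.exp (-(b * Real.sqrt y)))
      (Real.exp (-(b * Real.sqrt x)) * (-(b * (1 / (2 * Real.sqrt x))))) x :=
    (hsq.const_mul b).neg.exp
  -- the inverse power factor
  have hI : HasDerivAt (fun y => (Real.sqrt y)⁻¹) (-(1 / (2 * Real.sqrt x)) / Real.sqrt x ^ 2) x := hsq.inv hs.ne'
  have hP : HasDerivAt (fun y => (Real.sqrt y)⁻¹ ^ k)
      ((k : ℝ) * (Real.sqrt x)⁻¹ ^ (k - 1) * (-(1 / (2 * Real.sqrt x)) / Real.sqrt x ^ 2)) x := hI.pow k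
  have h := hE.mul hP
  refine h.congr_deriv ?_
  -- algebra: match the two expressions
  rcases Nat.eq_zero_or_pos k with rfl | hk
  · simp only [phi, pow_zero, Nat.cast_zero, zero_mul, mul_zero, add_zero, zero_div, neg_zero, zero_sub, zero_add,
      pow_succ, pow_zero, one_mul]
    field_simp
  · obtain ⟨j, rfl⟩ : ∃ j, k = j + 1 := ⟨k - 1, by omega⟩
    simp only [phi, Nat.add_sub_cancel, Nat.cast_add, Nat.cast_one]
    have e3 : (Real.sqrt x)⁻¹ ^ (j + 1 + 2) = (Real.sqrt x)⁻¹ ^ j * (Real.sqrt x)⁻¹ ^ 3 := by rw [← pow_add]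
    have e2 : (Real.sqrt x)⁻¹ ^ (j + 1 + 1) = (Real.sqrt x)⁻¹ ^ j * (Real.sqrt x)⁻¹ ^ 2 := by rw [← pow_add]
    have e1 : (Real.sqrt x)⁻¹ ^ (j + 1) = (Real.sqrt x)⁻¹ ^ j * (Real.sqrt x)⁻¹ := by rw [pow_succ]
    rw [e3, e2, e1]
    field_simp
    ring

/-- kernel: φ_k is differentiable, hence continuous, at every x > 0. [folklore] -/
private theorem continuousAt_phi (b : ℝ) (k : ℕ) {x : ℝ} (hx : 0 < x) : ContinuousAt (phi b k) x :=
  (hasDerivAt_phi b k hx).continuousAt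

/-! ## 2. The radial profile `F0(s) = e^{−b√(s+c)}/√(s+c)` and its first four derivatives -/

/-- F₀(s) = φ₁(s + c) = e^{−b√(s+c)}/√(s+c): the regularised Yukawa profile as a function of s = |y|² (c > 0 the
regularisation). [cite: Balaban1983Higgs3, (3.16) p.437] -/
def F0 (b c s : ℝ) : ℝ := phi b 1 (s + c)

/-- F₁ = F₀′ = −½(φ₃ + bφ₂)(· + c). [cite: Balaban1983Higgs3, (3.16) p.437] -/
def F1 (b c s : ℝ) : ℝ := -(1 / 2) * (phi b 3 (s + c) + b * phi b 2 (s + c))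

/-- F₂ = F₀″ = ¼(3φ₅ + 3bφ₄ + b²φ₃)(· + c). [cite: Balaban1983Higgs3, (3.16) p.437] -/
def F2 (b c s : ℝ) : ℝ := (1 / 4) * (3 * phi b 5 (s + c) + 3 * b * phi b 4 (s + c) + b ^ 2 * phi b 3 (s + c))

/-- F₃ = F₀‴ = −⅛(15φ₇ + 15bφ₆ + 6b²φ₅ + b³φ₄)(· + c). [cite: Balaban1983Higgs3, (3.16) p.437] -/
def F3 (b c s : ℝ) : ℝ :=
  -(1 / 8) * (15 * phi b 7 (s + c) + 15 * b * phi b 6 (s + c) + 6 * b ^ 2 * phi b 5 (s + c) + b ^ 3 * phi b 4 (s + c))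

/-- F₄ = F₀⁗ = (1/16)(105φ₉ + 105bφ₈ + 45b²φ₇ + 10b³φ₆ + b⁴φ₅)(· + c). [cite: Balaban1983Higgs3, (3.16) p.437] -/
def F4 (b c s : ℝ) : ℝ :=
  (1 / 16) * (105 * phi b 9 (s + c) + 105 * b * phi b 8 (s + c) + 45 * b ^ 2 * phi b 7 (s + c) +
    10 * b ^ 3 * phi b 6 (s + c) + b ^ 4 * phi b 5 (s + c))

section Derivatives

variable {b c s : ℝ}

/-- kernel: the shifted building block `s ↦ φ_k(s + c)` and its derivative. [folklore] -/
private theorem hasDerivAt_phi_shift (b c : ℝ) (k : ℕ) {s : ℝ} (h : 0 < s + c) :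
    HasDerivAt (fun t => phi b k (t + c)) (-((k : ℝ) / 2) * phi b (k + 2) (s + c) - b / 2 * phi b (k + 1) (s + c)) s := by
  have h1 : HasDerivAt (fun t : ℝ => t + c) 1 s := (hasDerivAt_id s).add_const c
  have h2 := (hasDerivAt_phi b k h).comp s h1
  rw [mul_one] at h2
  exact h2

/-- F₀′ = F₁ (s + c > 0). [cite: Balaban1983Higgs3, (3.16) p.437] -/
theorem hasDerivAt_F0 (h : 0 < s + c) : HasDerivAt (F0 b c) (F1 b c s) s := by
  have h1 := hasDerivAt_phi_shift b c 1 h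
  refine (h1.congr_of_eventuallyEq (Filter.Eventually.of_forall fun t => rfl)).congr_deriv ?_
  simp only [F1, Nat.cast_one]
  ring

/-- F₁′ = F₂ (s + c > 0). [cite: Balaban1983Higgs3, (3.16) p.437] -/
theorem hasDerivAt_F1 (h : 0 < s + c) : HasDerivAt (F1 b c) (F2 b c s) s := by
  have h3 := hasDerivAt_phi_shift b c 3 h
  have h2 := hasDerivAt_phi_shift b c 2 h
  have hs := (h3.add (h2.const_mul b)).const_mul (-(1 / 2 : ℝ))
  refine (hs.congr_of_eventuallyEq (Filter.Eventually.of_forall fun t => rfl)).congr_deriv ?_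
  simp only [F2]
  push_cast
  ring

/-- F₂′ = F₃ (s + c > 0). [cite: Balaban1983Higgs3, (3.16) p.437] -/
theorem hasDerivAt_F2 (h : 0 < s + c) : HasDerivAt (F2 b c) (F3 b c s) s := by
  have h5 := hasDerivAt_phi_shift b c 5 h
  have h4 := hasDerivAt_phi_shift b c 4 h
  have h3 := hasDerivAt_phi_shift b c 3 h
  have hs := ((h5.const_mul (3 : ℝ)).add ((h4.const_mul (3 * b)).add (h3.const_mul (b ^ 2)))).const_mul (1 / 4 : ℝ)
  refine (hs.congr_of_eventuallyEq (Filter.Eventually.of_forall fun t => ?_)).congr_deriv ?_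
  · simp only [F2, Pi.add_apply]; ring
  · simp only [F3]
    push_cast
    ring

/-- F₃′ = F₄ (s + c > 0). [cite: Balaban1983Higgs3, (3.16) p.437] -/
theorem hasDerivAt_F3 (h : 0 < s + c) : HasDerivAt (F3 b c) (F4 b c s) s := by
  have h7 := hasDerivAt_phi_shift b c 7 h
  have h6 := hasDerivAt_phi_shift b c 6 h
  have h5 := hasDerivAt_phi_shift b c 5 h
  have h4 := hasDerivAt_phi_shift b c 4 h
  have hs := ((h7.const_mul (15 : ℝ)).add ((h6.const_mul (15 * b)).add ((h5.const_mul (6 * b ^ 2)).add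
    (h4.const_mul (b ^ 3))))).const_mul (-(1 / 8) : ℝ)
  refine (hs.congr_of_eventuallyEq (Filter.Eventually.of_forall fun t => ?_)).congr_deriv ?_
  · simp only [F3, Pi.add_apply]; ring
  · simp only [F4]
    push_cast
    ring

end Derivatives

section Signs

variable {b c s : ℝ}

/-- kernel: F₀ > 0. [cite: Balaban1983Higgs3, (3.16) p.437] -/
theorem F0_pos (b : ℝ) (h : 0 < s + c) : 0 < F0 b c s := phi_pos b 1 h

/-- kernel: F₂ ≥ 0 for b ≥ 0 (complete monotonicity, even order). [cite: Balaban1983Higgs3, (3.16) p.437] -/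
theorem F2_nonneg (hb : 0 ≤ b) (c s : ℝ) : 0 ≤ F2 b c s := by
  unfold F2
  have := phi_nonneg b 5 (s + c); have := phi_nonneg b 4 (s + c); have := phi_nonneg b 3 (s + c)
  positivity

/-- kernel: F₄ ≥ 0 for b ≥ 0. [cite: Balaban1983Higgs3, (3.16) p.437] -/
theorem F4_nonneg (hb : 0 ≤ b) (c s : ℝ) : 0 ≤ F4 b c s := by
  unfold F4
  have := phi_nonneg b 9 (s + c); have := phi_nonneg b 8 (s + c); have := phi_nonneg b 7 (s + c)
  have := phi_nonneg b 6 (s + c); have := phi_nonneg b 5 (s + c)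
  positivity

/-- kernel: F₁ ≤ 0 for b ≥ 0 (odd order). [cite: Balaban1983Higgs3, (3.16) p.437] -/
theorem F1_nonpos (hb : 0 ≤ b) (c s : ℝ) : F1 b c s ≤ 0 := by
  unfold F1
  have := phi_nonneg b 3 (s + c); have := phi_nonneg b 2 (s + c)
  nlinarith

/-- kernel: F₂ is antitone on {s : s + c > 0} for b ≥ 0 (a nonnegative combination of antitone φ_k). [cite: Balaban1983Higgs3, (3.16) p.437] -/
theorem F2_antitone (hb : 0 ≤ b) {s s' : ℝ} (hs : 0 < s + c) (hss' : s ≤ s') : F2 b c s' ≤ F2 b c s := by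
  unfold F2
  have hle : s + c ≤ s' + c := by linarith
  have h5 := phi_antitone hb 5 hs hle
  have h4 := phi_antitone hb 4 hs hle
  have h3 := phi_antitone hb 3 hs hle
  nlinarith

/-- kernel: F₄ is antitone on {s : s + c > 0} for b ≥ 0. [cite: Balaban1983Higgs3, (3.16) p.437] -/
theorem F4_antitone (hb : 0 ≤ b) {s s' : ℝ} (hs : 0 < s + c) (hss' : s ≤ s') : F4 b c s' ≤ F4 b c s := by
  unfold F4
  have hle : s + c ≤ s' + c := by linarith
  have h9 := phi_antitone hb 9 hs hle
  have h8 := phi_antitone hb 8 hs hle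
  have h7 := phi_antitone hb 7 hs hle
  have h6 := phi_antitone hb 6 hs hle
  have h5 := phi_antitone hb 5 hs hle
  have hb2 : 0 ≤ b ^ 2 := sq_nonneg b
  have hb3 : 0 ≤ b ^ 3 := pow_nonneg hb 3
  have hb4 : 0 ≤ b ^ 4 := pow_nonneg hb 4
  nlinarith [mul_le_mul_of_nonneg_left h8 hb, mul_le_mul_of_nonneg_left h7 hb2, mul_le_mul_of_nonneg_left h6 hb3,
    mul_le_mul_of_nonneg_left h5 hb4]

/-- kernel: −F₁ is antitone, i.e. F₁ is monotone, on {s : s + c > 0} for b ≥ 0. [cite: Balaban1983Higgs3, (3.16) p.437] -/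
theorem F1_monotone (hb : 0 ≤ b) {s s' : ℝ} (hs : 0 < s + c) (hss' : s ≤ s') : F1 b c s ≤ F1 b c s' := by
  unfold F1
  have hle : s + c ≤ s' + c := by linarith
  have h3 := phi_antitone hb 3 hs hle
  have h2 := phi_antitone hb 2 hs hle
  nlinarith [mul_le_mul_of_nonneg_left h2 hb]

end Signs

/-! ## 3. Taylor-type bounds from monotone derivatives -/

section Taylor

variable {b c : ℝ}

/-- kernel: a function vanishing at 0 with nonpositive derivative on [0, T] is nonpositive on [0, T]. [folklore] -/
private theorem nonpos_on_Icc {g g' : ℝ → ℝ} {T : ℝ} (h0 : g 0 = 0)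
    (hg : ∀ t ∈ Icc (0 : ℝ) T, HasDerivAt g (g' t) t) (hg' : ∀ t ∈ Icc (0 : ℝ) T, g' t ≤ 0) :
    ∀ t ∈ Icc (0 : ℝ) T, g t ≤ 0 := by
  intro t ht
  have hanti : AntitoneOn g (Icc 0 T) :=
    antitoneOn_of_hasDerivWithinAt_nonpos (convex_Icc 0 T)
      (fun u hu => (hg u hu).continuousAt.continuousWithinAt)
      (fun u hu => (hg u (interior_subset hu)).hasDerivWithinAt) (fun u hu => hg' u (interior_subset hu))
  have hT : (0 : ℝ) ≤ T := ht.1.trans ht.2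
  have := hanti (left_mem_Icc.2 hT) ht ht.1
  rwa [h0] at this

/-- kernel: derivative of `t ↦ F(a + t)`. [folklore] -/
private theorem hasDerivAt_comp_const_add {F : ℝ → ℝ} {F' a t : ℝ} (h : HasDerivAt F F' (a + t)) :
    HasDerivAt (fun u => F (a + u)) F' t := by
  have h1 := h.comp t ((hasDerivAt_id t).const_add a)
  simp only [mul_one] at h1
  exact h1

/-- kernel: derivative of `t ↦ F(a − t)`. [folklore] -/
private theorem hasDerivAt_comp_const_sub {F : ℝ → ℝ} {F' a t : ℝ} (h : HasDerivAt F F' (a - t)) :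
    HasDerivAt (fun u => F (a - u)) (-F') t := by
  have h1 := h.comp t ((hasDerivAt_id t).const_sub a)
  simp only [mul_neg, mul_one] at h1
  exact h1

/-- **One-sided second-order Taylor bound** (third-order term ≤ 0 by complete monotonicity): for b ≥ 0 and s + c > 0,
`F₀(s + 1) ≤ F₀(s) + F₁(s) + ½F₂(s)` — used for the six nearest-neighbour values at squared radius s + 1.
[cite: Balaban1983Higgs3, (3.16) p.437] -/
theorem F0_add_one_le (hb : 0 ≤ b) {s : ℝ} (hs : 0 < s + c) :
    F0 b c (s + 1) ≤ F0 b c s + F1 b c s + (1 / 2) * F2 b c s := by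
  -- g1(t) = F1(s+t) − F1(s) − t·F2(s) ≤ 0 on [0,1]
  have hg1 : ∀ t ∈ Icc (0 : ℝ) 1, F1 b c (s + t) - F1 b c s - t * F2 b c s ≤ 0 := by
    refine nonpos_on_Icc (g' := fun t => F2 b c (s + t) - F2 b c s) (by simp) (fun t ht => ?_) (fun t ht => ?_)
    · have hst : 0 < s + t + c := by linarith [ht.1]
      have h1 : HasDerivAt (fun u => F1 b c (s + u)) (F2 b c (s + t)) t := hasDerivAt_comp_const_add (hasDerivAt_F1 hst)
      have h2 : HasDerivAt (fun u : ℝ => u * F2 b c s) (F2 b c s) t := by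
        simpa using (hasDerivAt_id t).mul_const (F2 b c s)
      exact (h1.sub_const (F1 b c s)).sub h2
    · have := F2_antitone hb hs (show s ≤ s + t by linarith [ht.1])
      linarith
  -- g(t) = F0(s+t) − F0(s) − t·F1(s) − (t²/2)·F2(s) ≤ 0 on [0,1]
  have hg : ∀ t ∈ Icc (0 : ℝ) 1, F0 b c (s + t) - F0 b c s - t * F1 b c s - t ^ 2 / 2 * F2 b c s ≤ 0 := by
    refine nonpos_on_Icc (g' := fun t => F1 b c (s + t) - F1 b c s - t * F2 b c s) (by simp) (fun t ht => ?_) hg1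
    have hst : 0 < s + t + c := by linarith [ht.1]
    have h1 : HasDerivAt (fun u => F0 b c (s + u)) (F1 b c (s + t)) t := hasDerivAt_comp_const_add (hasDerivAt_F0 hst)
    have h2 : HasDerivAt (fun u : ℝ => u * F1 b c s) (F1 b c s) t := by
      simpa using (hasDerivAt_id t).mul_const (F1 b c s)
    have h3 : HasDerivAt (fun u : ℝ => u ^ 2 / 2 * F2 b c s) (t * F2 b c s) t := by
      have := ((hasDerivAt_pow 2 t).div_const 2).mul_const (F2 b c s)
      refine this.congr_deriv ?_
      push_cast
      ring
    exact ((h1.sub_const (F0 b c s)).sub h2).sub h3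
  have := hg 1 ⟨zero_le_one, le_rfl⟩
  linarith

/-- **Symmetric fourth-order Taylor bound**: for b ≥ 0, 0 ≤ t ≤ T and σ − T + c > 0,
`F₀(σ + t) + F₀(σ − t) ≤ 2F₀(σ) + t²F₂(σ) + (t⁴/12)·F₄(σ − T)` (the odd orders cancel; F₄ is antitone, so its value at the
left end σ − T dominates the Lagrange remainders) — used along each coordinate with t = 2|y_ν|, σ = |y|² + 1.
[cite: Balaban1983Higgs3, (3.16) p.437] -/
theorem F0_symm_le (hb : 0 ≤ b) {σ T t : ℝ} (hσ : 0 < σ - T + c) (ht : t ∈ Icc (0 : ℝ) T) :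
    F0 b c (σ + t) + F0 b c (σ - t) ≤ 2 * F0 b c σ + t ^ 2 * F2 b c σ + t ^ 4 / 12 * F4 b c (σ - T) := by
  set M := F4 b c (σ - T) with hM
  have hpt : ∀ u ∈ Icc (0 : ℝ) T, 0 < σ + u + c ∧ 0 < σ - u + c := fun u hu =>
    ⟨by linarith [hu.1, hu.2], by linarith [hu.2]⟩
  -- order 4 → 3
  have h4 : ∀ u ∈ Icc (0 : ℝ) T, F3 b c (σ + u) - F3 b c (σ - u) - 2 * u * M ≤ 0 := by
    refine nonpos_on_Icc (g' := fun u => F4 b c (σ + u) + F4 b c (σ - u) - 2 * M) (by simp) (fun u hu => ?_)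
      (fun u hu => ?_)
    · obtain ⟨hp, hm⟩ := hpt u hu
      have h1 := hasDerivAt_comp_const_add (a := σ) (hasDerivAt_F3 (b := b) (c := c) hp)
      have h2 := hasDerivAt_comp_const_sub (a := σ) (hasDerivAt_F3 (b := b) (c := c) hm)
      have h3 : HasDerivAt (fun v : ℝ => 2 * v * M) (2 * M) u := by
        simpa using ((hasDerivAt_id u).const_mul (2 : ℝ)).mul_const M
      exact ((h1.sub h2).sub h3).congr_deriv (by ring)
    · have ha := F4_antitone hb hσ (show σ - T ≤ σ + u by linarith [hu.1, hu.2])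
      have hb' := F4_antitone hb hσ (show σ - T ≤ σ - u by linarith [hu.2])
      simp only [hM] at *
      linarith
  -- order 3 → 2
  have h3 : ∀ u ∈ Icc (0 : ℝ) T, F2 b c (σ + u) + F2 b c (σ - u) - 2 * F2 b c σ - u ^ 2 * M ≤ 0 := by
    refine nonpos_on_Icc (g' := fun u => F3 b c (σ + u) - F3 b c (σ - u) - 2 * u * M) (by simp; ring)
      (fun u hu => ?_) h4
    obtain ⟨hp, hm⟩ := hpt u hu
    have h1 := hasDerivAt_comp_const_add (a := σ) (hasDerivAt_F2 (b := b) (c := c) hp)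
    have h2 := hasDerivAt_comp_const_sub (a := σ) (hasDerivAt_F2 (b := b) (c := c) hm)
    have h3 : HasDerivAt (fun v : ℝ => v ^ 2 * M) (2 * u * M) u := by
      have := (hasDerivAt_pow 2 u).mul_const M
      refine this.congr_deriv ?_
      push_cast; ring
    exact (((h1.add h2).sub_const (2 * F2 b c σ)).sub h3).congr_deriv (by ring)
  -- order 2 → 1
  have h2 : ∀ u ∈ Icc (0 : ℝ) T, F1 b c (σ + u) - F1 b c (σ - u) - 2 * u * F2 b c σ - u ^ 3 / 3 * M ≤ 0 := by
    refine nonpos_on_Icc (g' := fun u => F2 b c (σ + u) + F2 b c (σ - u) - 2 * F2 b c σ - u ^ 2 * M) (by simp)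
      (fun u hu => ?_) h3
    obtain ⟨hp, hm⟩ := hpt u hu
    have h1 := hasDerivAt_comp_const_add (a := σ) (hasDerivAt_F1 (b := b) (c := c) hp)
    have h2 := hasDerivAt_comp_const_sub (a := σ) (hasDerivAt_F1 (b := b) (c := c) hm)
    have h3 : HasDerivAt (fun v : ℝ => 2 * v * F2 b c σ) (2 * F2 b c σ) u := by
      simpa using ((hasDerivAt_id u).const_mul (2 : ℝ)).mul_const (F2 b c σ)
    have h4' : HasDerivAt (fun v : ℝ => v ^ 3 / 3 * M) (u ^ 2 * M) u := by
      have := ((hasDerivAt_pow 3 u).div_const 3).mul_const M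
      refine this.congr_deriv ?_
      push_cast; ring
    exact (((h1.sub h2).sub h3).sub h4').congr_deriv (by ring)
  -- order 1 → 0
  have h1 : ∀ u ∈ Icc (0 : ℝ) T,
      F0 b c (σ + u) + F0 b c (σ - u) - 2 * F0 b c σ - u ^ 2 * F2 b c σ - u ^ 4 / 12 * M ≤ 0 := by
    refine nonpos_on_Icc (g' := fun u => F1 b c (σ + u) - F1 b c (σ - u) - 2 * u * F2 b c σ - u ^ 3 / 3 * M)
      (by simp; ring) (fun u hu => ?_) h2
    obtain ⟨hp, hm⟩ := hpt u hu
    have h1 := hasDerivAt_comp_const_add (a := σ) (hasDerivAt_F0 (b := b) (c := c) hp)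
    have h2 := hasDerivAt_comp_const_sub (a := σ) (hasDerivAt_F0 (b := b) (c := c) hm)
    have h3 : HasDerivAt (fun v : ℝ => v ^ 2 * F2 b c σ) (2 * u * F2 b c σ) u := by
      have := (hasDerivAt_pow 2 u).mul_const (F2 b c σ)
      refine this.congr_deriv ?_
      push_cast; ring
    have h4' : HasDerivAt (fun v : ℝ => v ^ 4 / 12 * M) (u ^ 3 / 3 * M) u := by
      have := ((hasDerivAt_pow 4 u).div_const 12).mul_const M
      refine this.congr_deriv ?_
      push_cast; ring
    exact ((((h1.add h2).sub_const (2 * F0 b c σ)).sub h3).sub h4').congr_deriv (by ring)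
  have := h1 t ht
  linarith

end Taylor

/-! ## 4. The lattice supersolution on ℤ³ -/

section Supersolution

/-- kernel: comparison of the building blocks at two nearby arguments — if 16x ≤ 25x′ and √x ≤ √x′ + 1 then
φ_k(x′) ≤ (5/3)(5/4)^k φ_k(x) for 0 ≤ b ≤ ½ (e^{1/2} ≤ 5/3). [folklore] -/
private theorem phi_le_of_near {b : ℝ} (hb : 0 ≤ b) (hb' : b ≤ 1 / 2) (k : ℕ) {x x' : ℝ} (hx : 0 < x)
    (h1 : 16 * x ≤ 25 * x') (h2 : Real.sqrt x ≤ Real.sqrt x' + 1) :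
    phi b k x' ≤ (5 / 3) * (5 / 4) ^ k * phi b k x := by
  have hx' : 0 < x' := by linarith
  have hsx : 0 < Real.sqrt x := Real.sqrt_pos.2 hx
  have hsx' : 0 < Real.sqrt x' := Real.sqrt_pos.2 hx'
  -- the exponential factor: e^{−b√x′} ≤ e^{1/2}·e^{−b√x} ≤ (5/3)e^{−b√x}
  have hexp : Real.exp (-(b * Real.sqrt x')) ≤ (5 / 3) * Real.exp (-(b * Real.sqrt x)) := by
    have hle : -(b * Real.sqrt x') ≤ 1 / 2 + -(b * Real.sqrt x) := by nlinarith
    have he : Real.exp (1 / 2 : ℝ) ≤ 5 / 3 := by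
      have h1 : Real.exp (1 / 2 : ℝ) ^ 2 = Real.exp 1 := by rw [← Real.exp_nat_mul]; norm_num
      have h3 : Real.exp 1 < 2.7182818286 := Real.exp_one_lt_d9
      nlinarith [Real.exp_pos (1 / 2 : ℝ)]
    calc Real.exp (-(b * Real.sqrt x')) ≤ Real.exp (1 / 2 + -(b * Real.sqrt x)) := Real.exp_le_exp.2 hle
      _ = Real.exp (1 / 2) * Real.exp (-(b * Real.sqrt x)) := Real.exp_add _ _
      _ ≤ (5 / 3) * Real.exp (-(b * Real.sqrt x)) :=
          mul_le_mul_of_nonneg_right he (Real.exp_pos _).le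
  -- the inverse square root: (√x′)⁻¹ ≤ (5/4)(√x)⁻¹
  have hinv : (Real.sqrt x')⁻¹ ≤ (5 / 4) * (Real.sqrt x)⁻¹ := by
    have hsq : Real.sqrt x ≤ (5 / 4) * Real.sqrt x' := by
      have : Real.sqrt (16 * x) ≤ Real.sqrt (25 * x') := Real.sqrt_le_sqrt h1
      rw [Real.sqrt_mul (by norm_num), Real.sqrt_mul (by norm_num),
        show Real.sqrt 16 = 4 by rw [show (16 : ℝ) = 4 ^ 2 by norm_num, Real.sqrt_sq (by norm_num)],
        show Real.sqrt 25 = 5 by rw [show (25 : ℝ) = 5 ^ 2 by norm_num, Real.sqrt_sq (by norm_num)]] at this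
      linarith
    rw [inv_le_comm₀ hsx' (by positivity), mul_inv, inv_inv]
    calc (5 / 4 : ℝ)⁻¹ * Real.sqrt x = (4 / 5) * Real.sqrt x := by norm_num
      _ ≤ Real.sqrt x' := by linarith
  have hpow : (Real.sqrt x')⁻¹ ^ k ≤ ((5 / 4) * (Real.sqrt x)⁻¹) ^ k :=
    pow_le_pow_left₀ (inv_nonneg.2 hsx'.le) hinv k
  unfold phi
  calc Real.exp (-(b * Real.sqrt x')) * (Real.sqrt x')⁻¹ ^ k
      ≤ ((5 / 3) * Real.exp (-(b * Real.sqrt x))) * ((5 / 4) * (Real.sqrt x)⁻¹) ^ k :=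
        mul_le_mul hexp hpow (pow_nonneg (inv_nonneg.2 hsx'.le) k) (by positivity)
    _ = (5 / 3) * (5 / 4) ^ k * (Real.exp (-(b * Real.sqrt x)) * (Real.sqrt x)⁻¹ ^ k) := by rw [mul_pow]; ring

/-- kernel: the fourth-order error coefficient at squared radius s + 1 − 2|y_ν| is controlled by the values at s itself:
for s ≥ r², 0 ≤ b ≤ ½, F₄(s + 1 − 2|r|) ≤ (5/3)(1/16)[105(5/4)⁹φ₉ + 105(5/4)⁸bφ₈ + 45(5/4)⁷b²φ₇ + 10(5/4)⁶b³φ₆ + (5/4)⁵b⁴φ₅](s + 64).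
[folklore] -/
private theorem F4_near_le {b : ℝ} (hb : 0 ≤ b) (hb' : b ≤ 1 / 2) {s r : ℝ} (hs : r ^ 2 ≤ s) :
    F4 b 64 (s + 1 - 2 * |r|) ≤ (5 / 3) * (1 / 16) * (105 * (5 / 4) ^ 9 * phi b 9 (s + 64) +
      105 * (5 / 4) ^ 8 * b * phi b 8 (s + 64) + 45 * (5 / 4) ^ 7 * b ^ 2 * phi b 7 (s + 64) +
      10 * (5 / 4) ^ 6 * b ^ 3 * phi b 6 (s + 64) + (5 / 4) ^ 5 * b ^ 4 * phi b 5 (s + 64)) := by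
  have hr0 : 0 ≤ |r| := abs_nonneg r
  have hr2 : |r| ^ 2 ≤ s := by rwa [sq_abs]
  set x := s + 64 with hxdef
  set x' := s + 1 - 2 * |r| + 64 with hx'def
  have hx : 0 < x := by rw [hxdef]; nlinarith
  have h1 : 16 * x ≤ 25 * x' := by rw [hxdef, hx'def]; nlinarith
  have h2 : Real.sqrt x ≤ Real.sqrt x' + 1 := by
    -- √x ≥ |r| and √x′ ≥ |r| − 1, with x − x′ = 2|r| − 1
    have hx'0 : 0 ≤ x' := by rw [hx'def]; nlinarith
    have hsx : |r| ≤ Real.sqrt x := Real.le_sqrt_of_sq_le (by rw [hxdef]; nlinarith)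
    by_cases hr1 : |r| ≤ 1
    · -- then x ≤ x′ + 1 ≤ (√x′ + 1)²
      apply Real.sqrt_le_iff.2
      constructor
      · positivity
      · have : x ≤ x' + 1 := by rw [hxdef, hx'def]; linarith
        nlinarith [Real.sq_sqrt hx'0, Real.sqrt_nonneg x']
    · push Not at hr1
      have hsx' : |r| - 1 ≤ Real.sqrt x' := Real.le_sqrt_of_sq_le (by rw [hx'def]; nlinarith)
      -- √x − √x′ = (x − x′)/(√x + √x′) ≤ (2|r| − 1)/(2|r| − 1) = 1
      have hsum : 2 * |r| - 1 ≤ Real.sqrt x + Real.sqrt x' := by linarith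
      have hpos : 0 < Real.sqrt x + Real.sqrt x' := by linarith
      have hdiff : (Real.sqrt x - Real.sqrt x') * (Real.sqrt x + Real.sqrt x') = x - x' := by
        nlinarith [Real.sq_sqrt hx.le, Real.sq_sqrt hx'0]
      have hxx' : x - x' = 2 * |r| - 1 := by rw [hxdef, hx'def]; ring
      by_contra hcon
      push Not at hcon
      have : (Real.sqrt x - Real.sqrt x') * (Real.sqrt x + Real.sqrt x') > 1 * (Real.sqrt x + Real.sqrt x') := by
        apply mul_lt_mul_of_pos_right _ hpos; linarith
      nlinarith
  have H9 := phi_le_of_near hb hb' 9 hx h1 h2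
  have H8 := phi_le_of_near hb hb' 8 hx h1 h2
  have H7 := phi_le_of_near hb hb' 7 hx h1 h2
  have H6 := phi_le_of_near hb hb' 6 hx h1 h2
  have H5 := phi_le_of_near hb hb' 5 hx h1 h2
  have hF4 : F4 b 64 (s + 1 - 2 * |r|) = (1 / 16) * (105 * phi b 9 x' + 105 * b * phi b 8 x' + 45 * b ^ 2 * phi b 7 x' +
      10 * b ^ 3 * phi b 6 x' + b ^ 4 * phi b 5 x') := by simp only [F4, hx'def]
  rw [hF4]
  have hb2 : 0 ≤ b ^ 2 := sq_nonneg b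
  have hb3 : 0 ≤ b ^ 3 := pow_nonneg hb 3
  have hb4 : 0 ≤ b ^ 4 := pow_nonneg hb 4
  nlinarith [mul_le_mul_of_nonneg_left H8 hb, mul_le_mul_of_nonneg_left H7 hb2, mul_le_mul_of_nonneg_left H6 hb3,
    mul_le_mul_of_nonneg_left H5 hb4]

/-- **The scalar inequality** behind the supersolution (u = √(s+64) ≥ 8, 0 ≤ b ≤ ½): the margin
3b²u⁸ + (253/4)(3u⁴ + 3bu⁵ + b²u⁶) dominates the fourth-order error (5/36)[105(5/4)⁹u⁴ + 105(5/4)⁸bu⁵ + 45(5/4)⁷b²u⁶ +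
10(5/4)⁶b³u⁷ + (5/4)⁵b⁴u⁸]. [folklore] -/
private theorem key_poly {u b : ℝ} (hu : 8 ≤ u) (hb : 0 ≤ b) (hb' : b ≤ 1 / 2) :
    0 ≤ 3 * b ^ 2 * u ^ 8 + (253 / 4) * (3 * u ^ 4 + 3 * b * u ^ 5 + b ^ 2 * u ^ 6) -
      (5 / 36) * u ^ 4 * (105 * (5 / 4) ^ 9 + 105 * (5 / 4) ^ 8 * b * u + 45 * (5 / 4) ^ 7 * b ^ 2 * u ^ 2 +
        10 * (5 / 4) ^ 6 * b ^ 3 * u ^ 3 + (5 / 4) ^ 5 * b ^ 4 * u ^ 4) := by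
  have hu0 : 0 ≤ u := by linarith
  have hu4 : 0 ≤ u ^ 4 := by positivity
  have hu5 : 0 ≤ u ^ 5 := by positivity
  have hu6 : 0 ≤ u ^ 6 := by positivity
  have hu7 : 0 ≤ u ^ 7 := by positivity
  -- the three lower-order coefficients are positive outright
  have c4 : 0 ≤ ((253 / 4) * 3 - (5 / 36) * 105 * (5 / 4 : ℝ) ^ 9) := by norm_num
  have c5 : 0 ≤ ((253 / 4) * 3 - (5 / 36) * 105 * (5 / 4 : ℝ) ^ 8) := by norm_num
  have c6 : 0 ≤ ((253 / 4) - (5 / 36) * 45 * (5 / 4 : ℝ) ^ 7) := by norm_num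
  -- the two top-order error terms are absorbed by 3b²u⁸ (b/u ≤ 1/16, b ≤ ½)
  have top : 0 ≤ 3 * u - (5 / 36) * 10 * (5 / 4 : ℝ) ^ 6 * b - (5 / 36) * (5 / 4 : ℝ) ^ 5 * b ^ 2 * u := by
    have k1 : (5 / 36) * 10 * (5 / 4 : ℝ) ^ 6 ≤ 6 := by norm_num
    have k2 : (5 / 36) * (5 / 4 : ℝ) ^ 5 ≤ 1 / 2 := by norm_num
    have hb2 : b ^ 2 ≤ 1 / 4 := by nlinarith
    have t1 : (5 / 36) * 10 * (5 / 4 : ℝ) ^ 6 * b ≤ 3 := by nlinarith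
    have t2 : (5 / 36) * (5 / 4 : ℝ) ^ 5 * b ^ 2 * u ≤ u / 8 := by
      have : (5 / 36) * (5 / 4 : ℝ) ^ 5 * b ^ 2 ≤ 1 / 8 := by nlinarith
      nlinarith
    linarith
  have e : 3 * b ^ 2 * u ^ 8 + (253 / 4) * (3 * u ^ 4 + 3 * b * u ^ 5 + b ^ 2 * u ^ 6) -
      (5 / 36) * u ^ 4 * (105 * (5 / 4) ^ 9 + 105 * (5 / 4) ^ 8 * b * u + 45 * (5 / 4) ^ 7 * b ^ 2 * u ^ 2 +
        10 * (5 / 4) ^ 6 * b ^ 3 * u ^ 3 + (5 / 4) ^ 5 * b ^ 4 * u ^ 4) =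
      ((253 / 4) * 3 - (5 / 36) * 105 * (5 / 4 : ℝ) ^ 9) * u ^ 4 +
      ((253 / 4) * 3 - (5 / 36) * 105 * (5 / 4 : ℝ) ^ 8) * (b * u ^ 5) +
      ((253 / 4) - (5 / 36) * 45 * (5 / 4 : ℝ) ^ 7) * (b ^ 2 * u ^ 6) +
      (b ^ 2 * u ^ 7) * (3 * u - (5 / 36) * 10 * (5 / 4 : ℝ) ^ 6 * b - (5 / 36) * (5 / 4 : ℝ) ^ 5 * b ^ 2 * u) := by
    ring
  rw [e]
  have t1 := mul_nonneg c4 hu4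
  have t2 := mul_nonneg c5 (mul_nonneg hb hu5)
  have t3 := mul_nonneg c6 (mul_nonneg (sq_nonneg b) hu6)
  have t4 := mul_nonneg (mul_nonneg (sq_nonneg b) hu7) top
  linarith

/-- **The key inequality** (the continuum margin (1 − a²)m² + c-regularisation beats the lattice fourth-order error): for
0 ≤ b ≤ ½ and s ≥ 0, with every φ at x = s + 64,
`4b²F₀ − 6F₁ − (3 + 4s)F₂ − (4/3)s²·E ≥ 0`, where E is the bound of `F4_near_le`. [folklore] -/
private theorem key_ineq {b : ℝ} (hb : 0 ≤ b) (hb' : b ≤ 1 / 2) {s : ℝ} (hs : 0 ≤ s) :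
    0 ≤ 4 * b ^ 2 * F0 b 64 s - 6 * F1 b 64 s - (3 + 4 * s) * F2 b 64 s -
      (4 / 3) * s ^ 2 * ((5 / 3) * (1 / 16) * (105 * (5 / 4) ^ 9 * phi b 9 (s + 64) +
        105 * (5 / 4) ^ 8 * b * phi b 8 (s + 64) + 45 * (5 / 4) ^ 7 * b ^ 2 * phi b 7 (s + 64) +
        10 * (5 / 4) ^ 6 * b ^ 3 * phi b 6 (s + 64) + (5 / 4) ^ 5 * b ^ 4 * phi b 5 (s + 64))) := by
  set x := s + 64 with hxdef
  have hx : 0 < x := by rw [hxdef]; linarith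
  set u := Real.sqrt x with hudef
  have hu : 8 ≤ u := by
    rw [hudef]
    exact Real.le_sqrt_of_sq_le (by rw [hxdef]; nlinarith)
  have hu0 : 0 < u := by linarith
  have hux : u ^ 2 = x := by rw [hudef]; exact Real.sq_sqrt hx.le
  set E := Real.exp (-(b * u)) with hEdef
  have hE : 0 < E := Real.exp_pos _
  -- every φ_k(x) = E·u⁻ᵏ
  have hphi : ∀ k : ℕ, phi b k (s + 64) = E * u⁻¹ ^ k := fun k => by simp only [phi, hEdef, hudef, hxdef]
  have hphix : ∀ k : ℕ, phi b k x = E * u⁻¹ ^ k := fun k => by simp only [phi, hEdef, hudef]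
  simp only [F0, F1, F2, hphi, hphix]
  have hsx : s = u ^ 2 - 64 := by linarith
  rw [hsx]
  have hP := key_poly hu hb hb'
  -- clear denominators: multiply the polynomial inequality by E·u⁻⁹ > 0 and compare
  have hu9 : 0 < u⁻¹ ^ 9 := pow_pos (inv_pos.2 hu0) 9
  have hui : u * u⁻¹ = 1 := mul_inv_cancel₀ hu0.ne'
  have key : 4 * b ^ 2 * (E * u⁻¹ ^ 1) - 6 * (-(1 / 2) * (E * u⁻¹ ^ 3 + b * (E * u⁻¹ ^ 2))) -
      (3 + 4 * (u ^ 2 - 64)) * (1 / 4 * (3 * (E * u⁻¹ ^ 5) + 3 * b * (E * u⁻¹ ^ 4) + b ^ 2 * (E * u⁻¹ ^ 3))) -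
      4 / 3 * (u ^ 2 - 64) ^ 2 * (5 / 3 * (1 / 16) * (105 * (5 / 4) ^ 9 * (E * u⁻¹ ^ 9) +
        105 * (5 / 4) ^ 8 * b * (E * u⁻¹ ^ 8) + 45 * (5 / 4) ^ 7 * b ^ 2 * (E * u⁻¹ ^ 7) +
        10 * (5 / 4) ^ 6 * b ^ 3 * (E * u⁻¹ ^ 6) + (5 / 4) ^ 5 * b ^ 4 * (E * u⁻¹ ^ 5))) =
      E * u⁻¹ ^ 9 * (3 * b ^ 2 * u ^ 8 + (253 / 4) * (3 * u ^ 4 + 3 * b * u ^ 5 + b ^ 2 * u ^ 6) -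
        (5 / 36) * (u ^ 2 - 64) ^ 2 * (105 * (5 / 4) ^ 9 + 105 * (5 / 4) ^ 8 * b * u +
          45 * (5 / 4) ^ 7 * b ^ 2 * u ^ 2 + 10 * (5 / 4) ^ 6 * b ^ 3 * u ^ 3 + (5 / 4) ^ 5 * b ^ 4 * u ^ 4)) := by
    field_simp
    ring
  rw [key]
  refine mul_nonneg (mul_pos hE hu9).le ?_
  -- (u² − 64)² ≤ u⁴ and the bracket is nonnegative
  have hbr : 0 ≤ 105 * (5 / 4 : ℝ) ^ 9 + 105 * (5 / 4) ^ 8 * b * u + 45 * (5 / 4) ^ 7 * b ^ 2 * u ^ 2 +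
      10 * (5 / 4) ^ 6 * b ^ 3 * u ^ 3 + (5 / 4) ^ 5 * b ^ 4 * u ^ 4 := by positivity
  have hsq : (u ^ 2 - 64) ^ 2 ≤ u ^ 4 := by nlinarith
  nlinarith [mul_le_mul_of_nonneg_right hsq hbr]

/-- The squared Euclidean norm |y|² = Σ_ν y_ν² of an integer site (real-valued). [cite: Balaban1983Higgs3, (3.16) p.437] -/
def sqn (y : ZSite 3) : ℝ := ∑ i : Fin 3, ((y i : ℤ) : ℝ) ^ 2

/-- The Euclidean norm |y| = (Σ_ν y_ν²)^{1/2} of an integer site — the |y − y′| of the print (y′ = 0), in lattice units.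
[cite: Balaban1983Higgs3, (3.16) p.437] -/
def enorm (y : ZSite 3) : ℝ := Real.sqrt (sqn y)

/-- kernel: |y|² ≥ 0. [cite: Balaban1983Higgs3, (3.16) p.437] -/
theorem sqn_nonneg (y : ZSite 3) : 0 ≤ sqn y := Finset.sum_nonneg fun _ _ => sq_nonneg _

/-- kernel: |y|² in coordinates. [folklore] -/
private theorem sqn_eq (y : ZSite 3) : sqn y = ((y 0 : ℤ) : ℝ) ^ 2 + ((y 1 : ℤ) : ℝ) ^ 2 + ((y 2 : ℤ) : ℝ) ^ 2 := by
  simp only [sqn, Fin.sum_univ_three]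

/-- kernel: y_ν² ≤ |y|². [folklore] -/
private theorem sq_le_sqn (y : ZSite 3) (ν : Fin 3) : ((y ν : ℤ) : ℝ) ^ 2 ≤ sqn y := by
  rw [sqn_eq]
  fin_cases ν <;> simp <;> nlinarith [sq_nonneg ((y 0 : ℤ) : ℝ), sq_nonneg ((y 1 : ℤ) : ℝ), sq_nonneg ((y 2 : ℤ) : ℝ)]

/-- kernel: |y|² = 0 only for y = 0. [cite: Balaban1983Higgs3, (3.16) p.437] -/
theorem sqn_pos {y : ZSite 3} (hy : y ≠ 0) : 0 < sqn y := by
  rw [sqn_eq]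
  have : y 0 ≠ 0 ∨ y 1 ≠ 0 ∨ y 2 ≠ 0 := by
    by_contra h
    push Not at h
    exact hy (funext fun i => by fin_cases i <;> simp [h.1, h.2.1, h.2.2])
  rcases this with h | h | h
  · have : ((y 0 : ℤ) : ℝ) ≠ 0 := by exact_mod_cast h
    positivity
  · have : ((y 1 : ℤ) : ℝ) ≠ 0 := by exact_mod_cast h
    positivity
  · have : ((y 2 : ℤ) : ℝ) ≠ 0 := by exact_mod_cast h
    positivity

/-- kernel: |y ± e_ν|² = |y|² + 1 ± 2y_ν. [folklore] -/
private theorem sqn_add_unitVec (y : ZSite 3) (ν : Fin 3) :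
    sqn (y + unitVec ν) = sqn y + 1 + 2 * ((y ν : ℤ) : ℝ) ∧ sqn (y - unitVec ν) = sqn y + 1 - 2 * ((y ν : ℤ) : ℝ) := by
  simp only [sqn_eq, unitVec, Pi.add_apply, Pi.sub_apply, Pi.single_apply]
  fin_cases ν <;> simp <;> constructor <;> ring

/-- kernel: Σ_ν y_ν⁴ ≤ (|y|²)². [folklore] -/
private theorem sum_pow_four_le (y : ZSite 3) : ∑ ν : Fin 3, ((y ν : ℤ) : ℝ) ^ 4 ≤ sqn y ^ 2 := by
  rw [sqn_eq, Fin.sum_univ_three]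
  nlinarith [sq_nonneg ((y 0 : ℤ) : ℝ), sq_nonneg ((y 1 : ℤ) : ℝ), sq_nonneg ((y 2 : ℤ) : ℝ),
    mul_nonneg (sq_nonneg ((y 0 : ℤ) : ℝ)) (sq_nonneg ((y 1 : ℤ) : ℝ)),
    mul_nonneg (sq_nonneg ((y 1 : ℤ) : ℝ)) (sq_nonneg ((y 2 : ℤ) : ℝ)),
    mul_nonneg (sq_nonneg ((y 0 : ℤ) : ℝ)) (sq_nonneg ((y 2 : ℤ) : ℝ))]

/-- **The comparison function** u_m(y) = e^{−(m/2)√(|y|²+64)}/√(|y|²+64) on ℤ³: a regularised Yukawa potential of mass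
m/2 ≤ the decay rate ½·m of the print (m = ξ in lattice units). [cite: Balaban1983Higgs3, (3.16) p.437] -/
def cmp (m : ℝ) (y : ZSite 3) : ℝ := F0 (m / 2) 64 (sqn y)

/-- kernel: the comparison function is positive. [cite: Balaban1983Higgs3, (3.16) p.437] -/
theorem cmp_pos (m : ℝ) (y : ZSite 3) : 0 < cmp m y := F0_pos _ (by linarith [sqn_nonneg y])

/-- **SUPERSOLUTION** — for 0 ≤ m ≤ 1 and every y ∈ ℤ³: (6 + m²)u_m(y) ≥ Σ_ν (u_m(y + e_ν) + u_m(y − e_ν)), i.e.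
(−Δ₁ + m²)u_m ≥ 0 on the whole lattice (the discretisation error of the second difference is of fourth order and is beaten by
the mass margin ¾m²u_m plus the regularisation margin). [cite: Balaban1983Higgs3, (3.16) p.437] -/
theorem lap_cmp_nonneg {m : ℝ} (hm : 0 ≤ m) (hm1 : m ≤ 1) (y : ZSite 3) :
    hop (cmp m) y ≤ (6 + m ^ 2) * cmp m y := by
  set b := m / 2 with hbdef
  have hb : 0 ≤ b := by rw [hbdef]; linarith
  have hb' : b ≤ 1 / 2 := by rw [hbdef]; linarith
  set s := sqn y with hsdef
  have hs : 0 ≤ s := sqn_nonneg y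
  -- the six neighbour values, coordinate by coordinate
  have hnb : ∀ ν : Fin 3, cmp m (y + unitVec ν) + cmp m (y - unitVec ν) ≤
      2 * F0 b 64 (s + 1) + (2 * |((y ν : ℤ) : ℝ)|) ^ 2 * F2 b 64 (s + 1) +
        (2 * |((y ν : ℤ) : ℝ)|) ^ 4 / 12 * F4 b 64 (s + 1 - 2 * |((y ν : ℤ) : ℝ)|) := by
    intro ν
    obtain ⟨hp, hmn⟩ := sqn_add_unitVec y ν
    set r := ((y ν : ℤ) : ℝ) with hrdef
    have hr2 : r ^ 2 ≤ s := sq_le_sqn y ν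
    have hσ : 0 < s + 1 - 2 * |r| + 64 := by nlinarith [abs_nonneg r, sq_abs r]
    have hT : 2 * |r| ∈ Icc (0 : ℝ) (2 * |r|) := ⟨by positivity, le_rfl⟩
    have key := F0_symm_le (c := 64) hb hσ hT
    -- {s+1+2y_ν, s+1−2y_ν} = {σ + t, σ − t} with t = 2|y_ν|
    have hpair : cmp m (y + unitVec ν) + cmp m (y - unitVec ν) = F0 b 64 (s + 1 + 2 * |r|) + F0 b 64 (s + 1 - 2 * |r|) := by
      simp only [cmp, ← hbdef, ← hsdef, hp, hmn]
      rcases le_or_gt 0 r with h | h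
      · rw [abs_of_nonneg h]
      · rw [abs_of_neg h]; ring_nf
    rw [hpair]
    exact key
  -- sum over the three directions
  have hsum : hop (cmp m) y ≤ 6 * F0 b 64 (s + 1) + 4 * s * F2 b 64 (s + 1) +
      (4 / 3) * s ^ 2 * ((5 / 3) * (1 / 16) * (105 * (5 / 4) ^ 9 * phi b 9 (s + 64) +
        105 * (5 / 4) ^ 8 * b * phi b 8 (s + 64) + 45 * (5 / 4) ^ 7 * b ^ 2 * phi b 7 (s + 64) +
        10 * (5 / 4) ^ 6 * b ^ 3 * phi b 6 (s + 64) + (5 / 4) ^ 5 * b ^ 4 * phi b 5 (s + 64))) := by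
    set Bnd := (5 / 3) * (1 / 16) * (105 * (5 / 4) ^ 9 * phi b 9 (s + 64) +
        105 * (5 / 4) ^ 8 * b * phi b 8 (s + 64) + 45 * (5 / 4) ^ 7 * b ^ 2 * phi b 7 (s + 64) +
        10 * (5 / 4) ^ 6 * b ^ 3 * phi b 6 (s + 64) + (5 / 4) ^ 5 * b ^ 4 * phi b 5 (s + 64)) with hBnd
    have hBnd0 : 0 ≤ Bnd := by
      rw [hBnd]
      have := phi_nonneg b 9 (s + 64); have := phi_nonneg b 8 (s + 64); have := phi_nonneg b 7 (s + 64)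
      have := phi_nonneg b 6 (s + 64); have := phi_nonneg b 5 (s + 64)
      positivity
    have hterm : ∀ ν : Fin 3, cmp m (y + unitVec ν) + cmp m (y - unitVec ν) ≤
        2 * F0 b 64 (s + 1) + 4 * ((y ν : ℤ) : ℝ) ^ 2 * F2 b 64 (s + 1) + (4 / 3) * ((y ν : ℤ) : ℝ) ^ 4 * Bnd := by
      intro ν
      have h1 := hnb ν
      have h2 := F4_near_le hb hb' (sq_le_sqn y ν)
      rw [← hsdef, ← hBnd] at h2
      have h4 : 0 ≤ (2 * |((y ν : ℤ) : ℝ)|) ^ 4 / 12 := by positivity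
      have h3 := mul_le_mul_of_nonneg_left h2 h4
      have e2 : (2 * |((y ν : ℤ) : ℝ)|) ^ 2 = 4 * ((y ν : ℤ) : ℝ) ^ 2 := by rw [mul_pow, sq_abs]; norm_num
      have e4 : (2 * |((y ν : ℤ) : ℝ)|) ^ 4 / 12 = (4 / 3) * ((y ν : ℤ) : ℝ) ^ 4 := by
        have : |((y ν : ℤ) : ℝ)| ^ 4 = ((y ν : ℤ) : ℝ) ^ 4 := by
          rw [show |((y ν : ℤ) : ℝ)| ^ 4 = (|((y ν : ℤ) : ℝ)| ^ 2) ^ 2 by ring, sq_abs]; ring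
        rw [mul_pow, this]; ring
      rw [e2] at h1
      nlinarith
    calc hop (cmp m) y = ∑ ν : Fin 3, (cmp m (y + unitVec ν) + cmp m (y - unitVec ν)) := rfl
      _ ≤ ∑ ν : Fin 3, (2 * F0 b 64 (s + 1) + 4 * ((y ν : ℤ) : ℝ) ^ 2 * F2 b 64 (s + 1) +
          (4 / 3) * ((y ν : ℤ) : ℝ) ^ 4 * Bnd) := Finset.sum_le_sum fun ν _ => hterm ν
      _ = 6 * F0 b 64 (s + 1) + 4 * s * F2 b 64 (s + 1) + (4 / 3) * (∑ ν : Fin 3, ((y ν : ℤ) : ℝ) ^ 4) * Bnd := by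
          rw [hsdef, sqn, Fin.sum_univ_three, Fin.sum_univ_three, Fin.sum_univ_three]; ring
      _ ≤ 6 * F0 b 64 (s + 1) + 4 * s * F2 b 64 (s + 1) + (4 / 3) * s ^ 2 * Bnd := by
          have := sum_pow_four_le y
          rw [← hsdef] at this
          nlinarith [mul_le_mul_of_nonneg_right this hBnd0]
  -- Taylor at s and the key inequality
  have h01 := F0_add_one_le (c := 64) hb (s := s) (by linarith)
  have h2 := F2_antitone (c := 64) hb (s := s) (s' := s + 1) (by linarith) (by linarith)
  have hk := key_ineq hb hb' hs
  have hm2 : m ^ 2 = 4 * b ^ 2 := by rw [hbdef]; ring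
  have hcmp : cmp m y = F0 b 64 s := rfl
  rw [hcmp, hm2]
  have hs4 : 0 ≤ 4 * s := by linarith
  nlinarith [mul_le_mul_of_nonneg_left h2 hs4]

/-- κ₀ = 3e^{−√65/2}/(√65)³: a lower bound for (−Δ₁ + m²)u_m at the origin, uniform in 0 ≤ m ≤ 1.
[cite: Balaban1983Higgs3, (3.16) p.437] -/
def kappa0 : ℝ := 3 * (Real.exp (-(1 / 2 * Real.sqrt 65)) * (Real.sqrt 65)⁻¹ ^ 3)

/-- kernel: κ₀ > 0. [cite: Balaban1983Higgs3, (3.16) p.437] -/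
theorem kappa0_pos : 0 < kappa0 := by
  unfold kappa0
  have : 0 < Real.sqrt 65 := Real.sqrt_pos.2 (by norm_num)
  positivity

/-- **At the origin** the supersolution has a source: (6 + m²)u_m(0) − Σ_ν (u_m(e_ν) + u_m(−e_ν)) ≥ κ₀ > 0 for 0 ≤ m ≤ 1
(convexity of the profile: F₀(0) − F₀(1) ≥ −F₁(1) ≥ ½φ₃(65) ≥ κ₀/3·… ). [cite: Balaban1983Higgs3, (3.16) p.437] -/
theorem lap_cmp_zero {m : ℝ} (hm : 0 ≤ m) (hm1 : m ≤ 1) :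
    kappa0 ≤ (6 + m ^ 2) * cmp m 0 - hop (cmp m) 0 := by
  set b := m / 2 with hbdef
  have hb : 0 ≤ b := by rw [hbdef]; linarith
  have hb' : b ≤ 1 / 2 := by rw [hbdef]; linarith
  have h0 : sqn (0 : ZSite 3) = 0 := by simp [sqn]
  have hhop : hop (cmp m) 0 = 6 * F0 b 64 1 := by
    have hν : ∀ ν : Fin 3, cmp m ((0 : ZSite 3) + unitVec ν) + cmp m (0 - unitVec ν) = 2 * F0 b 64 1 := by
      intro ν
      obtain ⟨hp, hmn⟩ := sqn_add_unitVec (0 : ZSite 3) ν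
      simp only [h0, Pi.zero_apply, Int.cast_zero, mul_zero, add_zero, sub_zero, zero_add] at hp hmn
      simp only [cmp, zero_add, hp, hmn, ← hbdef]; ring
    calc hop (cmp m) 0 = ∑ ν : Fin 3, (cmp m ((0 : ZSite 3) + unitVec ν) + cmp m (0 - unitVec ν)) := rfl
      _ = ∑ _ν : Fin 3, 2 * F0 b 64 1 := Finset.sum_congr rfl fun ν _ => hν ν
      _ = 6 * F0 b 64 1 := by rw [Finset.sum_const, Finset.card_univ, Fintype.card_fin]; simp; ring
  have hc0 : cmp m 0 = F0 b 64 0 := by simp only [cmp, h0, ← hbdef]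
  rw [hhop, hc0]
  -- convexity: F₀(1) − F₀(0) ≤ F₁(1)
  have hconv : F0 b 64 1 - F0 b 64 0 - F1 b 64 1 ≤ 0 := by
    have h := nonpos_on_Icc (T := 1) (g := fun t => F0 b 64 t - F0 b 64 0 - t * F1 b 64 1)
      (g' := fun t => F1 b 64 t - F1 b 64 1) (by simp) (fun t ht => ?_) (fun t ht => ?_)
    · simpa using h 1 ⟨zero_le_one, le_rfl⟩
    · have hd := hasDerivAt_F0 (b := b) (c := 64) (s := t) (by linarith [ht.1])
      have h2 : HasDerivAt (fun u : ℝ => u * F1 b 64 1) (F1 b 64 1) t := by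
        simpa using (hasDerivAt_id t).mul_const (F1 b 64 1)
      exact (hd.sub_const _).sub h2
    · have := F1_monotone (c := 64) hb (s := t) (s' := 1) (by linarith [ht.1]) ht.2
      linarith
  -- −F₁(1) ≥ ½φ₃(65) ≥ κ₀/6·2
  have hF1 : (1 / 2) * phi b 3 65 ≤ -F1 b 64 1 := by
    simp only [F1, show (1 : ℝ) + 64 = 65 by norm_num]
    have := phi_nonneg b 2 65
    nlinarith
  have hphi : Real.exp (-(1 / 2 * Real.sqrt 65)) * (Real.sqrt 65)⁻¹ ^ 3 ≤ phi b 3 65 := by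
    unfold phi
    refine mul_le_mul_of_nonneg_right (Real.exp_le_exp.2 ?_) (pow_nonneg (inv_nonneg.2 (Real.sqrt_nonneg _)) 3)
    have := Real.sqrt_nonneg 65
    nlinarith
  unfold kappa0
  have hF0z := F0_pos b (s := (0 : ℝ)) (c := 64) (by norm_num)
  have hmF : 0 ≤ m ^ 2 * F0 b 64 0 := mul_nonneg (sq_nonneg m) hF0z.le
  nlinarith

end Supersolution

/-! ## 5. The discrete maximum principle on ℤ³ and the comparison -/

section MaxPrinciple

/-- kernel: the hopping sum of a pointwise combination. [folklore] -/
private theorem hop_lin (a : ℝ) (f g : ZSite 3 → ℝ) (y : ZSite 3) :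
    hop (fun z => a * f z - g z) y = a * hop f y - hop g y := by
  simp only [hop, Finset.mul_sum, ← Finset.sum_sub_distrib]
  exact Finset.sum_congr rfl fun _ _ => by ring

/-- kernel: the hopping sum of a scalar multiple. [folklore] -/
private theorem hop_smul' (a : ℝ) (f : ZSite 3 → ℝ) (y : ZSite 3) : hop (fun z => a * f z) y = a * hop f y := by
  simp only [hop, Finset.mul_sum]
  exact Finset.sum_congr rfl fun _ _ => by ring

/-- kernel: a lower bound for the hopping sum from a pointwise lower bound. [folklore] -/
private theorem le_hop_of_le {f : ZSite 3 → ℝ} {I : ℝ} (hI : ∀ z, I ≤ f z) (y : ZSite 3) : 6 * I ≤ hop f y := by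
  unfold hop
  calc 6 * I = ∑ _ν : Fin 3, (I + I) := by
        rw [Finset.sum_const, Finset.card_univ, Fintype.card_fin]; simp; ring
    _ ≤ ∑ ν : Fin 3, (f (y + unitVec ν) + f (y - unitVec ν)) :=
        Finset.sum_le_sum fun ν _ => add_le_add (hI _) (hI _)

/-- **DISCRETE MAXIMUM PRINCIPLE** for −Δ₁ + m² on the infinite lattice ℤ³ (m > 0): a function bounded below and
satisfying (6 + m²)f(y) ≥ Σ_ν (f(y + e_ν) + f(y − e_ν)) everywhere is nonnegative.  (At a point where f is within the
factor 6/(6 + m²) of its infimum I < 0 the six neighbours cannot sum below 6I.) [cite: Balaban1983Higgs3, (3.16) p.437] -/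
theorem nonneg_of_superSol {m : ℝ} (hm : 0 < m) {f : ZSite 3 → ℝ} (hbdd : BddBelow (Set.range f))
    (hsup : ∀ y, hop f y ≤ (6 + m ^ 2) * f y) (y : ZSite 3) : 0 ≤ f y := by
  by_contra hneg
  push Not at hneg
  set I := ⨅ z, f z with hIdef
  have hI : ∀ z, I ≤ f z := fun z => ciInf_le hbdd z
  have hIneg : I < 0 := (hI y).trans_lt hneg
  have hm2 : 0 < 6 + m ^ 2 := by positivity
  have hlt : I < 6 * I / (6 + m ^ 2) := by
    rw [lt_div_iff₀ hm2]
    have : I * m ^ 2 < 0 := mul_neg_of_neg_of_pos hIneg (pow_pos hm 2)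
    nlinarith [this]
  obtain ⟨z, hz⟩ := exists_lt_of_ciInf_lt hlt
  have h6 : 6 * I ≤ hop f z := le_hop_of_le hI z
  have hz' : (6 + m ^ 2) * f z < 6 * I := by
    have := (lt_div_iff₀ hm2).1 hz; linarith
  linarith [hsup z]

/-- The comparison constant A = κ₀⁻¹ = (√65)³e^{√65/2}/3 — the printed "O(1)", independent of the lattice spacing.
[cite: Balaban1983Higgs3, (3.16) p.437] -/
def cmpConst : ℝ := kappa0⁻¹

/-- kernel: A > 0. [cite: Balaban1983Higgs3, (3.16) p.437] -/
theorem cmpConst_pos : 0 < cmpConst := inv_pos.2 kappa0_pos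

/-- **COMPARISON** — every bounded solution of (−Δ₁ + m²)K = δ₀ on ℤ³ (0 < m ≤ 1), i.e.
(6 + m²)K(y) − Σ_ν (K(y + e_ν) + K(y − e_ν)) = [y = 0], lies below A·u_m: `K ≤ cmpConst·cmp m`.
[cite: Balaban1983Higgs3, (3.16) p.437] -/
theorem le_cmpConst_mul_cmp {m : ℝ} (hm : 0 < m) (hm1 : m ≤ 1) {K : ZSite 3 → ℝ} {B : ℝ} (hK : ∀ y, |K y| ≤ B)
    (heq : ∀ y, (6 + m ^ 2) * K y - hop K y = if y = 0 then 1 else 0) (y : ZSite 3) :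
    K y ≤ cmpConst * cmp m y := by
  set f : ZSite 3 → ℝ := fun z => cmpConst * cmp m z - K z with hf
  have hbdd : BddBelow (Set.range f) := by
    refine ⟨-B, ?_⟩
    rintro _ ⟨z, rfl⟩
    have h1 := (abs_le.1 (hK z)).2
    have h2 := mul_pos cmpConst_pos (cmp_pos m z)
    simp only [hf]; linarith
  have hsup : ∀ z, hop f z ≤ (6 + m ^ 2) * f z := by
    intro z
    rw [hf, hop_lin]
    have hz := heq z
    have hs := lap_cmp_nonneg hm.le hm1 z
    by_cases h0 : z = 0
    · subst h0
      have h00 := lap_cmp_zero hm.le hm1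
      simp only [if_true] at hz
      have hA : cmpConst * kappa0 = 1 := inv_mul_cancel₀ kappa0_pos.ne'
      nlinarith [mul_le_mul_of_nonneg_left h00 cmpConst_pos.le]
    · simp only [h0, if_false] at hz
      nlinarith [mul_le_mul_of_nonneg_left hs cmpConst_pos.le]
  have := nonneg_of_superSol hm hbdd hsup y
  simp only [hf] at this
  linarith

/-- **THE YUKAWA BOUND on ℤ³** — every bounded solution of (−Δ₁ + m²)K = δ₀ (0 < m ≤ 1) satisfies
K(y) ≤ A·e^{−(m/2)|y|}/|y| for y ≠ 0, |y| the Euclidean norm, A = `cmpConst` independent of m.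
[cite: Balaban1983Higgs3, (3.16) p.437] -/
theorem green_le {m : ℝ} (hm : 0 < m) (hm1 : m ≤ 1) {K : ZSite 3 → ℝ} {B : ℝ} (hK : ∀ y, |K y| ≤ B)
    (heq : ∀ y, (6 + m ^ 2) * K y - hop K y = if y = 0 then 1 else 0) {y : ZSite 3} (hy : y ≠ 0) :
    K y ≤ cmpConst * (Real.exp (-(m / 2 * enorm y)) / enorm y) := by
  have h1 := le_cmpConst_mul_cmp hm hm1 hK heq y
  have hs : 0 < sqn y := sqn_pos hy
  have h2 : cmp m y ≤ Real.exp (-(m / 2 * enorm y)) / enorm y := by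
    have := phi_antitone (b := m / 2) (by linarith) 1 hs (show sqn y ≤ sqn y + 64 by linarith)
    simp only [cmp, F0]
    refine this.trans (le_of_eq ?_)
    simp only [phi, enorm, pow_one, div_eq_mul_inv]
  exact h1.trans (mul_le_mul_of_nonneg_left h2 cmpConst_pos.le)

end MaxPrinciple

/-! ## 6. The printed inequality for the free propagator C^ξ on ξℤ³ -/

section Cxi

variable {ξ : ℝ}

/-- kernel: r15's lattice equation (−Δ^ξ + 1)C^ξ = ξ^{−3}1₀ in lattice units — K := ξ·C^ξ solves
(6 + ξ²)K(y) − Σ_ν (K(y + e_ν) + K(y − e_ν)) = [y = 0]. [cite: Balaban1983Higgs3, (3.16) p.437] -/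
theorem lattice_eq_smul_Cxi (hξ : 0 < ξ) (y : ZSite 3) :
    (6 + ξ ^ 2) * (ξ * Cxi 3 ξ y) - hop (fun z => ξ * Cxi 3 ξ z) y = if y = 0 then 1 else 0 := by
  have h := negLapZ_Cxi_add (d := 3) hξ y
  rw [negLapZ_eq_hop] at h
  rw [hop_smul']
  have hξ0 : ξ ≠ 0 := hξ.ne'
  have e : (6 + ξ ^ 2) * (ξ * Cxi 3 ξ y) - ξ * hop (Cxi 3 ξ) y =
      ξ ^ 3 * (ξ⁻¹ ^ 2 * (2 * (3 : ℕ) * Cxi 3 ξ y - hop (Cxi 3 ξ) y) + Cxi 3 ξ y) := by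
    push_cast
    field_simp
    ring
  rw [e, h]
  split_ifs
  · field_simp
  · simp

/-- kernel: |ξ·C^ξ| ≤ ξ^{−2} (from r15's a-priori bound |C^ξ| ≤ ξ^{−3}). [cite: Balaban1983Higgs3, (3.16) p.437] -/
theorem abs_smul_Cxi_le (hξ : 0 < ξ) (y : ZSite 3) : |ξ * Cxi 3 ξ y| ≤ ξ⁻¹ ^ 2 := by
  rw [abs_mul, abs_of_pos hξ]
  have h := abs_Cxi_le (d := 3) hξ y
  calc ξ * |Cxi 3 ξ y| ≤ ξ * ξ⁻¹ ^ 3 := mul_le_mul_of_nonneg_left h hξ.le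
    _ = ξ⁻¹ ^ 2 := by field_simp

/-- **[Balaban1983Higgs3] p. 437, the printed inequality |C^ξ(y − y′)| ≦ O(1)e^{−½|y−y′|}/|y − y′| — PROVED** (d = 3,
0 < ξ ≤ 1, y ≠ y′; translation invariance of C^ξ lets y′ = 0): with the physical Euclidean distance ξ|y| of the
site y ∈ ℤ³ of ξℤ³, `C^ξ(y) ≤ A·e^{−½·ξ|y|}/(ξ|y|)`, A = `cmpConst` independent of ξ.  Independent comparison-principle
witness; the theorem of record for C^ξ on ξℤ³ is seat p39's. [cite: Balaban1983Higgs3, (3.16) p.437] -/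
theorem Cxi_le_yukawa (hξ : 0 < ξ) (hξ1 : ξ ≤ 1) {y : ZSite 3} (hy : y ≠ 0) :
    Cxi 3 ξ y ≤ cmpConst * (Real.exp (-(1 / 2 * (ξ * enorm y))) / (ξ * enorm y)) := by
  have hK := green_le (K := fun z => ξ * Cxi 3 ξ z) hξ hξ1 (abs_smul_Cxi_le hξ) (lattice_eq_smul_Cxi hξ) hy
  have hen : 0 < enorm y := Real.sqrt_pos.2 (sqn_pos hy)
  have e1 : -(ξ / 2 * enorm y) = -(1 / 2 * (ξ * enorm y)) := by ring
  rw [e1] at hK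
  rw [show Cxi 3 ξ y = ξ⁻¹ * (ξ * Cxi 3 ξ y) by field_simp]
  calc ξ⁻¹ * (ξ * Cxi 3 ξ y) ≤ ξ⁻¹ * (cmpConst * (Real.exp (-(1 / 2 * (ξ * enorm y))) / enorm y)) :=
        mul_le_mul_of_nonneg_left hK (inv_nonneg.2 hξ.le)
    _ = cmpConst * (Real.exp (-(1 / 2 * (ξ * enorm y))) / (ξ * enorm y)) := by
        field_simp

/-- **The printed inequality with the absolute value**: |C^ξ(y)| ≤ A·e^{−½ξ|y|}/(ξ|y|) (C^ξ ≥ 0 by r15's `Cxi_nonneg`).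
[cite: Balaban1983Higgs3, (3.16) p.437] -/
theorem abs_Cxi_le_yukawa (hξ : 0 < ξ) (hξ1 : ξ ≤ 1) {y : ZSite 3} (hy : y ≠ 0) :
    |Cxi 3 ξ y| ≤ cmpConst * (Real.exp (-(1 / 2 * (ξ * enorm y))) / (ξ * enorm y)) := by
  rw [abs_of_nonneg (Cxi_nonneg (d := 3) hξ y)]
  exact Cxi_le_yukawa hξ hξ1 hy

/-- The sup norm |y|_∞ = max_ν |y_ν| of an integer site (real-valued). [cite: Balaban1983Higgs3, (3.16) p.437] -/
def supn (y : ZSite 3) : ℝ := ((Finset.univ.sup fun i : Fin 3 => (y i).natAbs : ℕ) : ℝ)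

/-- kernel: |y|_∞ ≤ |y|₂. [cite: Balaban1983Higgs3, (3.16) p.437] -/
theorem supn_le_enorm (y : ZSite 3) : supn y ≤ enorm y := by
  unfold supn
  have h : ∀ i : Fin 3, ((y i).natAbs : ℝ) ≤ enorm y := by
    intro i
    have e : ((y i).natAbs : ℝ) = |((y i : ℤ) : ℝ)| := by
      rw [← Int.cast_natCast, Int.natCast_natAbs, Int.cast_abs]
    rw [e]
    exact Real.abs_le_sqrt (sq_le_sqn y i)
  obtain ⟨i, -, hi⟩ := Finset.exists_mem_eq_sup (Finset.univ : Finset (Fin 3)) Finset.univ_nonempty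
    (fun i : Fin 3 => (y i).natAbs)
  rw [hi]
  exact h i

/-- kernel: |y|_∞ ≥ 1 for y ≠ 0. [cite: Balaban1983Higgs3, (3.16) p.437] -/
theorem one_le_supn {y : ZSite 3} (hy : y ≠ 0) : 1 ≤ supn y := by
  unfold supn
  have : ∃ i : Fin 3, y i ≠ 0 := by
    by_contra h
    push Not at h
    exact hy (funext h)
  obtain ⟨i, hi⟩ := this
  have h1 : 1 ≤ (y i).natAbs := Int.natAbs_pos.2 hi
  have h2 : (y i).natAbs ≤ Finset.univ.sup fun j : Fin 3 => (y j).natAbs :=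
    Finset.le_sup (f := fun j : Fin 3 => (y j).natAbs) (Finset.mem_univ i)
  exact_mod_cast h1.trans h2

/-- **Sup-norm form** of the printed inequality (the form used with `supDist` on the tori downstream): for 0 < ξ ≤ 1,
y ≠ 0, |C^ξ(y)| ≤ A·e^{−½ξ|y|_∞}/(ξ|y|_∞) (weaker than the Euclidean form since |y|_∞ ≤ |y|₂).
[cite: Balaban1983Higgs3, (3.16) p.437] -/
theorem abs_Cxi_le_yukawa_sup (hξ : 0 < ξ) (hξ1 : ξ ≤ 1) {y : ZSite 3} (hy : y ≠ 0) :
    |Cxi 3 ξ y| ≤ cmpConst * (Real.exp (-(1 / 2 * (ξ * supn y))) / (ξ * supn y)) := by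
  refine (abs_Cxi_le_yukawa hξ hξ1 hy).trans (mul_le_mul_of_nonneg_left ?_ cmpConst_pos.le)
  have h1 := supn_le_enorm y
  have h2 : 0 < supn y := lt_of_lt_of_le one_pos (one_le_supn hy)
  have h3 : 0 < ξ * supn y := mul_pos hξ h2
  have h4 : ξ * supn y ≤ ξ * enorm y := mul_le_mul_of_nonneg_left h1 hξ.le
  rw [div_le_div_iff₀ (by linarith) h3]
  have h5 : Real.exp (-(1 / 2 * (ξ * enorm y))) ≤ Real.exp (-(1 / 2 * (ξ * supn y))) :=
    Real.exp_le_exp.2 (by linarith)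
  exact mul_le_mul h5 h4 h3.le (Real.exp_pos _).le

end Cxi

end

end Literature.MathematicalPhysics.QuantumFieldTheory.Balaban1983to89.B3CxiComparisonBound
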